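import Literature.Barriers.KontsevichZagierPeriods.AlgebraicPrimitivesObstruction

/-!
# No REAL-semialgebraic primitive of `1/(t − 2)` on `[0,1]`

Support for the negative side of crux `CompleteModGammaSector` (§5A of
`Cruxes/CompleteModGammaSector/Disproof.lean`, cdisprove gen 1): the tree's barrier
`noSemialgebraicPrimitive_inv_sub_two_holds` (Ayoub Rem. 1.2 / Fresán Rem. 3.6) re-run with REAL
coefficients — `noRealSemialgebraicPrimitive_inv_sub_two`. Only step (A) of the tree's proof
(`NoSemialgPrim.exists_ne_zero_isOpen`, stated for `ℚ`) needed the generalisation to an arbitrary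
coefficient ring `k → ℝ` (`exists_ne_zero_isOpen_of`); steps (B)–(D) are reused verbatim.
-/

noncomputable section

open MeasureTheory Set
open scoped BigOperators Topology

namespace Summit.KontsevichZagierPeriods.CompleteModGammaSectorNegative

open Literature.NumberTheory.Transcendental
open Literature.ModelTheory.ExponentialFields (IsSemialgebraic)

/-! ### §5A The barrier over real coefficients -/

/-- Step (A) of the tree's barrier proof, for an arbitrary coefficient ring `k → ℝ` (verbatim
generalisation of `NoSemialgPrim.exists_ne_zero_isOpen`, which is stated for `k = ℚ`): every
`k`-semialgebraic subset of `ℝ²` is, off the zero set of some non-zero real polynomial, both open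
and closed. [folklore] -/
theorem exists_ne_zero_isOpen_of {k : Type*} [CommRing k] [Algebra k ℝ] {S : Set (Fin 2 → ℝ)}
    (hS : IsSemialgebraic k S) :
    ∃ q : MvPolynomial (Fin 2) ℝ, q ≠ 0 ∧ IsOpen (S ∩ {z | MvPolynomial.eval z q ≠ 0}) ∧
      IsOpen (Sᶜ ∩ {z | MvPolynomial.eval z q ≠ 0}) := by
  have eval_map : ∀ (p : MvPolynomial (Fin 2) k) (z : Fin 2 → ℝ),
      MvPolynomial.eval z (MvPolynomial.map (algebraMap k ℝ) p) = MvPolynomial.aeval z p := by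
    intro p z
    rw [MvPolynomial.eval_map, MvPolynomial.aeval_def]
  unfold Literature.ModelTheory.ExponentialFields.IsSemialgebraic
    Literature.ModelTheory.ExponentialFields.semialgebraicSets at hS
  induction hS using BooleanSubalgebra.closure_bot_sup_induction with
  | mem S hS =>
    rcases hS with ⟨p, rfl⟩ | ⟨p, rfl⟩
    · by_cases hp : MvPolynomial.map (algebraMap k ℝ) p = 0
      · have hall : ∀ z : Fin 2 → ℝ, MvPolynomial.aeval z p = 0 := fun z => by
          rw [← eval_map, hp, map_zero]
        refine ⟨1, one_ne_zero, ?_, ?_⟩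
        · convert isOpen_univ
          ext z
          simp [hall z]
        · convert isOpen_empty
          ext z
          simp [hall z]
      · refine ⟨_, hp, ?_, ?_⟩
        · convert isOpen_empty
          ext z
          simp only [mem_inter_iff, mem_setOf_eq, eval_map, mem_empty_iff_false,
            iff_false, not_and, not_not]
          exact fun h => h
        · convert Literature.Barriers.KontsevichZagierPeriods.KZ.NoSemialgPrim.isOpen_eval_ne_zero
            (MvPolynomial.map (algebraMap k ℝ) p) using 1
          ext z
          simp only [mem_inter_iff, mem_compl_iff, mem_setOf_eq, eval_map]
          tauto
    · by_cases hp : MvPolynomial.map (algebraMap k ℝ) p = 0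
      · have hall : ∀ z : Fin 2 → ℝ, MvPolynomial.aeval z p = 0 := fun z => by
          rw [← eval_map, hp, map_zero]
        refine ⟨1, one_ne_zero, ?_, ?_⟩
        · convert isOpen_empty
          ext z
          simp [hall z]
        · convert isOpen_univ
          ext z
          simp [hall z]
      · refine ⟨_, hp, ?_, ?_⟩
        · have hopen : IsOpen {z : Fin 2 → ℝ | 0 < MvPolynomial.eval z
              (MvPolynomial.map (algebraMap k ℝ) p)} :=
            isOpen_lt continuous_const (MvPolynomial.continuous_eval _)
          convert hopen using 1
          ext z
          simp only [mem_inter_iff, mem_setOf_eq, eval_map]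
          exact ⟨fun h => h.1, fun h => ⟨h, h.ne'⟩⟩
        · have hopen : IsOpen {z : Fin 2 → ℝ | MvPolynomial.eval z
              (MvPolynomial.map (algebraMap k ℝ) p) < 0} :=
            isOpen_lt (MvPolynomial.continuous_eval _) continuous_const
          convert hopen using 1
          ext z
          simp only [mem_inter_iff, mem_compl_iff, mem_setOf_eq, eval_map, not_lt]
          exact ⟨fun h => lt_of_le_of_ne h.1 h.2, fun h => ⟨h.le, h.ne⟩⟩
  | bot =>
    exact ⟨1, one_ne_zero, by simp, by simp⟩
  | sup S hS T hT ihS ihT =>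
    obtain ⟨p, hp, hp1, hp2⟩ := ihS
    obtain ⟨q, hq, hq1, hq2⟩ := ihT
    refine ⟨p * q, mul_ne_zero hp hq, ?_, ?_⟩
    · have : ((S ⊔ T) ∩ {z : Fin 2 → ℝ | MvPolynomial.eval z (p * q) ≠ 0}) =
          (S ∩ {z | MvPolynomial.eval z p ≠ 0}) ∩ {z | MvPolynomial.eval z q ≠ 0} ∪
            (T ∩ {z | MvPolynomial.eval z q ≠ 0}) ∩ {z | MvPolynomial.eval z p ≠ 0} := by
        ext z
        simp only [sup_eq_union, mem_inter_iff, mem_union, mem_setOf_eq, map_mul, mul_ne_zero_iff]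
        tauto
      rw [this]
      exact (hp1.inter (Literature.Barriers.KontsevichZagierPeriods.KZ.NoSemialgPrim.isOpen_eval_ne_zero q)).union
        (hq1.inter (Literature.Barriers.KontsevichZagierPeriods.KZ.NoSemialgPrim.isOpen_eval_ne_zero p))
    · have : ((S ⊔ T)ᶜ ∩ {z : Fin 2 → ℝ | MvPolynomial.eval z (p * q) ≠ 0}) =
          (Sᶜ ∩ {z | MvPolynomial.eval z p ≠ 0}) ∩ (Tᶜ ∩ {z | MvPolynomial.eval z q ≠ 0}) := by
        ext z
        simp only [sup_eq_union, compl_union, mem_inter_iff, mem_compl_iff, mem_setOf_eq, map_mul,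
          mul_ne_zero_iff]
        tauto
      rw [this]
      exact hp2.inter hq2
  | compl S hS ih =>
    obtain ⟨p, hp, h1, h2⟩ := ih
    exact ⟨p, hp, h2, by simpa only [compl_compl] using h1⟩

open Polynomial in
open scoped Polynomial.Bivariate in
/-- **The barrier over REAL coefficients**: no `ℝ`-semialgebraic function on `[0, 1]` (real
parameters allowed) has derivative `1/(t − 2)` on `(0, 1)`. Same proof as the tree's
`noSemialgebraicPrimitive_inv_sub_two_holds` (steps (A)–(D)); only step (A) needed the coefficient
generalisation `exists_ne_zero_isOpen_of`. [cite: Fresan2024, Rem. 3.6] [cite: Ayoub2015, Rem. 1.2] -/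
theorem noRealSemialgebraicPrimitive_inv_sub_two :
    ¬ ∃ F : (Fin 1 → ℝ) → ℝ, IsSemialgebraicFunOn ℝ {x | x 0 ∈ Icc (0 : ℝ) 1} F ∧
      ∀ t ∈ Ioo (0 : ℝ) 1, HasDerivAt (fun s : ℝ => F (fun _ => s)) (1 / (t - 2)) t := by
  rintro ⟨F, hF, hderiv⟩
  set Γ : Set (Fin 2 → ℝ) :=
    {z | ∃ x ∈ {x : Fin 1 → ℝ | x 0 ∈ Icc (0 : ℝ) 1}, z = Fin.snoc x (F x)} with hΓ
  have hΓ' : IsSemialgebraic ℝ Γ := hF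
  obtain ⟨q, hq0, hopen, -⟩ := exists_ne_zero_isOpen_of hΓ'
  have hvan : ∀ z ∈ Γ, MvPolynomial.eval z q = 0 := by
    intro z hz
    by_contra hne
    obtain ⟨ε, hε, hball⟩ := Metric.isOpen_iff.mp hopen z ⟨hz, hne⟩
    obtain ⟨x, hx, rfl⟩ := hz
    have hmem : (Fin.snoc x (F x + ε / 2) : Fin 2 → ℝ) ∈
        Metric.ball (Fin.snoc x (F x) : Fin 2 → ℝ) ε := by
      rw [Metric.mem_ball, dist_pi_lt_iff hε]
      intro i
      fin_cases i
      · simp [Fin.snoc, hε]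
      · simp [Fin.snoc, abs_of_pos hε, half_lt_self hε]
    obtain ⟨⟨x', -, hxx'⟩, -⟩ := hball hmem
    have h0 : x = x' := by
      funext j
      fin_cases j
      simpa [Fin.snoc] using congrFun hxx' 0
    have h1 := congrFun hxx' 1
    simp only [Fin.snoc] at h1
    simp [← h0] at h1
    exact absurd h1 hε.ne'
  set P : ℝ[X][Y] := (Polynomial.Bivariate.equivMvPolynomial ℝ).symm q with hP
  have hP0 : P ≠ 0 := by simpa [hP] using hq0
  have hPv : ∀ t ∈ Ioo (0 : ℝ) 1, P.evalEval t (F fun _ => t) = 0 := by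
    intro t ht
    have hz : (Fin.snoc (fun _ : Fin 1 => t) (F fun _ => t) : Fin 2 → ℝ) ∈ Γ :=
      ⟨fun _ => t, Ioo_subset_Icc_self ht, rfl⟩
    have h := hvan _ hz
    rw [← Literature.Barriers.KontsevichZagierPeriods.KZ.NoSemialgPrim.evalEval_equivMvPolynomial_symm] at h
    simpa [Fin.snoc] using h
  exact hP0 (Literature.Barriers.KontsevichZagierPeriods.KZ.NoSemialgPrim.eq_zero_of_evalEval_eq_zero
    hderiv P.natDegree P le_rfl hPv)

end Summit.KontsevichZagierPeriods.CompleteModGammaSectorNegative
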